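import Mathlib
import Literature.MathematicalPhysics.KineticTheory.HardSphereEulerProofs
import Literature.Analysis.FluidPDE.HardSphereAlexander
import HarnessLib

/-!
# ShearStressHalfDrudeAllN — a REFUTED proposition, kept deprecated as the target of its refutation

Topic `Literature/Uncategorized`. This module holds ONE constant, relocated here by the gate from
`Summits/AtomisticToContinuum/HydrodynamicLimit/Theorems/ShearStressHalfDrude/Negative/FalseForAllN.lean`
(accept-time relocation of tagged propositions written inline in a Summits proposal; human ruling 2026-08-15):

* `Literature.Uncategorized.ShearStressHalfDrudeAllN` — **FALSE, refuted in the tree, deprecated.** It is the route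
  crux `Summit.AtomisticToContinuum.HydrodynamicLimit.Theses.AntiMazurCoboundaries.ShearStressHalfDrude`
  (item stmt-AtomisticToContinuum-14136) with its restriction to large particle number removed
  (`∃ N₀, ∀ N, N₀ ≤ N → …` ↦ `∀ N, …`), a strengthening minted by the standing disprover of that crux to show that the
  restriction is load-bearing. Its negation is the theorem
  `Summit.AtomisticToContinuum.HydrodynamicLimit.Theorems.ShearStressHalfDrudeOneSphere.not_shearStressHalfDrudeAllN`
  (module `Summits.AtomisticToContinuum.HydrodynamicLimit.Theorems.ShearStressHalfDrude.Negative.FalseForAllN`;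
  sorry-free, axioms `propext, Classical.choice, Quot.sound`, re-checked 2026-08-16): for ONE sphere (`N = 0`,
  `a = θ = 1`, `u₀ = 0`, `e₁ = (1,0,0) ⊥ e₂ = (0,1,0)`, `A = 1`, `φ = 1`, any diameter `σ < 1/2`, the flow given by
  the tree's Alexander theorem `HardSphereFlow.nonempty_torus_holds`) the motion is free flight, the velocity is
  frozen, the window average of `g` over `[0, τ]` is `g` itself, so the left side equals the full static second
  moment `∫ g² dγ > 0` while the right side is `½ ∫ g² dγ` — false at every window `τ > 0`.

## Verdict clean-up (2026-08-16): not literature debt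

The constant is **not a literature fact**: it has no source (no published text states it; the crux it strengthens
is itself an unproved route item), it is false as written, and `ShearStressHalfDrudeAllN_holds` can never be proved
(verdict of its tenured prove seat: `refuted … not-a-fact`). It is therefore retired from the named-fact debt:
the declaration is `@[deprecated]` with a pointer to the refuting theorem, and its docstring says what is wrong.
**Name and body are kept byte-for-byte** — the refuting theorem's type is literally
`¬ Literature.Uncategorized.ShearStressHalfDrudeAllN`, and that module is its only importer in the build — so the
constant cannot be deleted or turned into a parametrised predicate without breaking the refutation (a Summits
Theorems file, append-only). Nothing else should ever use it; a file that must name it (a refutation) silences the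
deprecation warning with `set_option linter.deprecated false in` and a one-line justification. The POSITIVE
statement one might want instead is exactly the crux `…Theses.AntiMazurCoboundaries.ShearStressHalfDrude`
(uniformity only for `N ≥ N₀`), which is a route item, not literature, and is not restated here.
-/

namespace Literature.Uncategorized

open MeasureTheory ProbabilityTheory Filter Set Topology Real
open scoped ENNReal NNReal InnerProductSpace
open Literature.MathematicalPhysics.KineticTheory Literature.Analysis.FluidPDE

/-- **Deprecated — REFUTED as stated; a FALSE proposition, NOT a literature fact; kept (name and body
unchanged) only as the target of its refutation
`Summit.AtomisticToContinuum.HydrodynamicLimit.Theorems.ShearStressHalfDrudeOneSphere.not_shearStressHalfDrudeAllN`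
(module `Summits.AtomisticToContinuum.HydrodynamicLimit.Theorems.ShearStressHalfDrude.Negative.FalseForAllN`).**
It is the crux `Summit.AtomisticToContinuum.HydrodynamicLimit.Theses.AntiMazurCoboundaries.ShearStressHalfDrude`
(stmt-AtomisticToContinuum-14136: at some kinetic window `τ (N+1)^{-1/3}` at most HALF of the static variance
`(N+1) ∫ φ² ∫ g² dγ` of the cutoff shear stress `g(w) = ⟨e₁,w⟩⟨e₂,w⟩(1 - smoothTransition(‖w‖²/A² - 1))`,
`e₁ ⊥ e₂`, of `N + 1` hard spheres at fixed reduced density is ballistic, uniformly in `N ≥ N₀`) with the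
restriction to large `N` removed (`∃ N₀, ∀ N, N₀ ≤ N → …` ↦ `∀ N, …`), written by the standing disprover of
that crux and relocated here by the gate. **What is wrong:** without `N ≥ N₀` the statement covers ONE free
sphere (`N = 0`), which never collides and never decorrelates, so for `φ = 1` the windowed second moment is the
full static variance `∫ g² dγ = 2 ×` the right-hand side, at every window — the negation is proved in the module
named above (sorry-free, standard axioms; verdict of the prove seat 2026-08-16: refuted, not-a-fact, no source,
`_holds` unprovable). The lesson it records for the crux: collisions / the restriction `N ≥ N₀` are load-bearing.
Do not use this constant; a theorem that must name it (its refutation) writes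
`set_option linter.deprecated false in` before itself. No source exists or is claimed. [folklore] -/
@[deprecated "REFUTED as stated (false already for one free sphere, N = 0): see theorem \
    Summit.AtomisticToContinuum.HydrodynamicLimit.Theorems.ShearStressHalfDrudeOneSphere.not_shearStressHalfDrudeAllN \
    (module Summits.AtomisticToContinuum.HydrodynamicLimit.Theorems.ShearStressHalfDrude.Negative.FalseForAllN); \
    the intended positive statement is the route crux \
    Summit.AtomisticToContinuum.HydrodynamicLimit.Theses.AntiMazurCoboundaries.ShearStressHalfDrude (N ≥ N₀ only)"
  (since := "2026-08-16")]
def ShearStressHalfDrudeAllN : Prop :=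
  ∀ (a θ : ℝ) (u₀ : Literature.MathematicalPhysics.KineticTheory.V3), 0 < a → 0 < θ → ∃ σ₀ : ℝ, 0 < σ₀ ∧ ∀ σ : ℝ, 0 < σ → σ < σ₀ → (∀ (N : ℕ) (Φ : Literature.Analysis.FluidPDE.HardSphereFlow (Literature.Analysis.FluidPDE.Torus.geometry (Fin 3)) (Literature.MathematicalPhysics.KineticTheory.hsDiameter σ N) (N + 1)), MeasureTheory.IsProbabilityMeasure (Literature.MathematicalPhysics.KineticTheory.localGibbsLaw σ (fun _ => a) (fun _ => u₀) (fun _ => θ) N Φ)) ∧ ∀ (e₁ e₂ : Literature.MathematicalPhysics.KineticTheory.V3), inner ℝ e₁ e₂ = 0 → ∀ A : ℝ, 0 < A → ∀ g : Literature.MathematicalPhysics.KineticTheory.V3 → ℝ, (g = fun w => inner ℝ e₁ w * inner ℝ e₂ w * (1 - Real.smoothTransition (‖w‖ ^ 2 / A ^ 2 - 1))) → ∀ φ : Literature.MathematicalPhysics.KineticTheory.T3 → ℝ, Continuous φ → ∃ τ : ℝ, 0 < τ ∧ ∀ N : ℕ, ∀ Φ : Literature.Analysis.FluidPDE.HardSphereFlow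 (Literature.Analysis.FluidPDE.Torus.geometry (Fin 3)) (Literature.MathematicalPhysics.KineticTheory.hsDiameter σ N) (N + 1), ∫⁻ z, ENNReal.ofReal (((τ * ((N + 1 : ℕ) : ℝ) ^ (-(1 / 3 : ℝ)))⁻¹ * ∫ s in (0 : ℝ)..(τ * ((N + 1 : ℕ) : ℝ) ^ (-(1 / 3 : ℝ))), ∑ i, φ (Φ.flow s z i).1 * g ((Real.sqrt θ)⁻¹ • ((Φ.flow s z i).2 - u₀))) ^ 2) ∂(Literature.MathematicalPhysics.KineticTheory.localGibbsLaw σ (fun _ => a) (fun _ => u₀) (fun _ => θ) N Φ) ≤ ENNReal.ofReal ((1 / 2) * (((N : ℝ)) + 1) * (∫ x, φ x ^ 2) * ∫ v, g v ^ 2 ∂(ProbabilityTheory.stdGaussian Literature.MathematicalPhysics.KineticTheory.V3))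

end Literature.Uncategorized
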